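import Literature.NumberTheory.EllipticCurves.PointReduction
import Literature.NumberTheory.EllipticCurves.HasseWeilGoodReductionFrobenius
import Literature.NumberTheory.EllipticCurves.SelmerFiniteProofs
import Literature.NumberTheory.EllipticCurves.GaloisActionProofs
import Literature.NumberTheory.EllipticCurves.FrobeniusTateModuleProofs
import Literature.NumberTheory.EllipticCurves.FrobeniusSeparableProofs
import Literature.NumberTheory.GaloisRepresentations.IntegralGaloisActionProofs
import HarnessLib

/-!
# The reduction isomorphism `T_ℓ E ≅ T_ℓ Ẽ_v` intertwining Frobenius with Frobenius:
# discharge of `WeierstrassCurve.galoisRepTate_frobenius_conj_reductionAt`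

`Proofs` companion of `Literature/NumberTheory/EllipticCurves/HasseWeilGoodReductionFrobenius.lean`,
whose third named fact `WeierstrassCurve.galoisRepTate_frobenius_conj_reductionAt W ℓ` — *for an
elliptic curve `E/K` over a number field, `v ∤ ℓ` a finite place of good reduction, `𝔓 ∣ v`,
`σ ∈ Gal(K̄/K)` an arithmetic Frobenius at `𝔓` and `φ ∈ Γ_{k_v}` the `q_v`-power Frobenius,
there is a `ℤ_ℓ`-linear isomorphism `e : T_ℓ E ≃ T_ℓ Ẽ_v` with `e ∘ ρ_{E,ℓ}(σ) = ρ_{Ẽ_v,ℓ}(φ) ∘ e`*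
(Diamond–Shurman, *A First Course in Modular Forms*, proof of Thm. 9.4.1, held PDF pp. 421–422:
the diagram `D_𝔭 → Aut(E[ℓⁿ]) → Aut(Ẽ[ℓⁿ])`, "the reduction preserves `ℓⁿ`-torsion structure";
Silverman, *AEC*, proof of Prop. VII.4.1 with VII.3.1(b), VII.2.1, III.6.4(b)) — is **proved**
here (`WeierstrassCurve.galoisRepTate_frobenius_conj_reductionAt_holds`).  With it the tree's
chain for the Euler factors of `E` at the good places (Silverman C.§16 / C.21 Remark 21.3,
`hasseWeilEulerFactor_of_hasGoodReduction`, feeding lang.S28 through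
`Automorphic/Sweep1PotentialModularityFrobeniusProofs`) rests only on facts about elliptic curves
over finite fields and the Weil pairing (§5).

## The proof

Printed proof (Diamond–Shurman 9.4.1; Silverman VII.4.1, VII.3.1(b)): reduce `ℓⁿ`-torsion points
modulo a prime above `v`; the reduction map `E[ℓⁿ] → Ẽ_v[ℓⁿ]` is an injective homomorphism
(VII.2.1, VII.3.1(b)) between groups of order `ℓ²ⁿ` (III.6.4(b)), hence an isomorphism, and a
Frobenius in the decomposition group reduces to the `q_v`-power map; pass to the limit.  Here:

* §1 **Local Frobenius and the residue map.**  For a prime `𝔐` of the local absolute integers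
  `\bar 𝓞_v ⊆ K̄_v` (`SelmerInertia`) there is `σ_v ∈ Γ_{K_v}` with `σ_v b ≡ b^{q_v} (mod 𝔐)`
  (`exists_isArithFrobAt_localAbsIntegers`: the tree's profinite existence theorem
  `Literature.NumberTheory.GaloisRepresentations.exists_isArithFrobAt_of_isInvariant_of_profinite` for `Γ_{K_v}` acting on `\bar 𝓞_v`,
  invariants `𝓞_v`; Neukirch II (9.9)), and a ring homomorphism `r : 𝒪_w → k̄_v` of the
  valuation ring of the spectral valuation `w = |·|_v` (`SelmerFiniteProofs`; `𝒪_w = \bar 𝓞_v`,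
  Neukirch II (6.2)) with kernel `𝔐`, compatible with `𝓞_v → k_v`, carrying `σ_v` to
  `x ↦ x^{q_v}` (`exists_residueMap`: `\bar 𝓞_v/𝔐` is algebraic over `k_v`, embed it into
  `k̄_v` by `IsAlgClosed.lift`).
* §2 **Two algebraic lemmas**: an injective homomorphism `A[p^∞] → B` with `#B[pⁿ] ≤ #A[pⁿ] < ∞`
  hits every `pⁿ`-torsion element (`exists_eq_of_injective_of_card_torsionBy_le`), and such an
  `f` induces `T_p A ≃ T_p B` (`TateModule.exists_linearEquiv_of_primaryComponent`).
* §3 **The reduction map on `ℓ`-primary torsion** (`exists_reduceTorsionHom`): along a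
  `K`-embedding `ι : K̄ → K̄_v`, transport `E(K̄) → E(K̄_v) ≃ M(K̄_v)` to the good model
  `M = W.localMinimalIntegralModel v` by the chosen change of variables over `K_v` (as in
  `SelmerFiniteProofs`: `pointsMapOfEmb`, `pointEquivBaseChange`, both `Γ_{K_v}`-equivariant),
  where `ℓ`-primary torsion is prime-to-`p` torsion (`|ℓⁿ|_v = 1`), and reduce with
  `Literature.NumberTheory.EllipticCurves.reduceHom` of `PointReduction` (VII.2.1 on integral points, injective by VII.3.1(b)) into
  `(W.reductionAt v)(k̄_v)` — the reduced equation of `M_{K̄_v}` under `r` *is*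
  `Ẽ_v ⊗ k̄_v`.  Equivariance `f (σ_v|_{K̄} P) = φ (f P)` since `r (σ_v z) = (r z)^{q_v}`.
* §4 **The discharge** (`galoisRepTate_frobenius_conj_reductionAt_holds`): counting
  (`card_torsionPoints_eq_sq_holds`, III.6.4(b), for `E/K̄` and for `Ẽ_v/k̄_v`) and §2 give
  `e₀ : T_ℓ E ≃ T_ℓ Ẽ_v` intertwining `σ₀ = σ_v|_{K̄}` — an arithmetic Frobenius at the prime
  `𝔓_{ι,𝔐}` cut out by `ι` (`isArithFrobAt_resGalOfEmb`) — with `φ`.  For the given `(𝔓, σ)`: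
  `τ 𝔓_{ι,𝔐} = 𝔓` for some `τ` (transitivity, `exists_smul_eq_of_mem_primesAbove_holds`),
  `τ σ₀ τ⁻¹` is a Frobenius at `𝔓` (`IsArithFrobAt.conj`), `σ (τ σ₀ τ⁻¹)⁻¹ ∈ I_𝔓`
  (`IsArithFrobAt.mul_inv_mem_inertia`) acts trivially on `T_ℓ E` (VII.4.1(b),
  `galoisRepTate_eq_one_of_mem_inertia`, file `GoodReductionUnramifiedProofs`), so
  `ρ(σ) = ρ(τ) ρ(σ₀) ρ(τ)⁻¹` and `e = e₀ ∘ ρ(τ⁻¹)` works.  (This replaces the decomposition-group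
  half of Neukirch II (9.6), not in the tree, by its inertia half plus a local Frobenius.)
* §5 **Consequences**: the trace fact `trace_galoisRepTate_frobenius_of_hasGoodReductionAt` from
  V.2.3.1 for the reductions (`…_of_finiteField`); the Euler factors
  `hasseWeilEulerFactor_of_hasGoodReduction` from the Weil pairing and V.2.3.1
  (`…_of_weilPairing_of_finiteField`), and from the Weil pairings (on `E` and on the `Ẽ_v`),
  III.8.6 and III.4.10(a) (`…_of_weilPairing_of_deg`, through `FrobeniusTateModuleProofs` and the
  proved III.5.5 `isSeparable_oneSubFrobeniusIsogeny_holds`).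

## References

* [DiamondShurman2005] F. Diamond, J. Shurman, *A First Course in Modular Forms*, GTM 228,
  Springer 2005 (held: `book:diamond2005-first-course-modular-forms`): Thm. 9.4.1 and its proof
  (PDF pp. 421–422).
* [SilvermanAEC2009] J. H. Silverman, *The Arithmetic of Elliptic Curves*, 2nd ed., GTM 106,
  Springer 2009 (held: `book:silverman2009-arithmetic-elliptic-curves-2nd-ed`): Prop. VII.2.1
  (PDF p. 167), Prop. VII.3.1(b) (p. 170), Prop. VII.4.1 and its proof (p. 173), Cor. III.6.4(b),
  Thm. V.2.3.1, C.§16 and C.21 Remark 21.3 (p. 399).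
* [NeukirchANT1999] J. Neukirch, *Algebraic Number Theory*, Springer 1999: Ch. II (4.8), (6.2),
  §9 (9.6), (9.9) (residue field extension of `K̄_v/K_v`, `G → G(λ|κ)` onto).

## Mathlib / tree reuse

Mathlib: `IsArithFrobAt` (`conj`, `mul_inv_mem_inertia`), `Ideal.Quotient.algebraQuotientOfLEComap`,
`Ideal.isMaximal_of_isIntegral_of_isMaximal_comap`, `IsIntegral.tower_top`, `IsAlgClosed.lift`,
`Function.Injective.bijective_of_nat_card_le`, `AddSubgroup.torsionBy.nsmul_iff`,
`AddCommGroup.primaryComponent`, `LinearEquiv.ofBijective`.  Tree: `PointReduction`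
(`reduceHom`, `injective_reduceHom`, `reducePoint_some`, …); `SelmerFiniteProofs`
(`exists_spectralValuation`, `mem_localAbsIntegers_iff_spectralValuation`,
`mem_iff_spectralValuation_lt_one`, `spectralValuation_smul`, `spectralValuation_intCast_eq_one`,
`isIntegral_spectralValuation_baseChange`, `spectralValuation_Δ_baseChange`, `congrEquiv_smul`,
`Affine.Point.congrEquiv_baseChange_map`); `SelmerInertia` (`localAbsIntegers`,
`localPrimesAbove(_nonempty)`, `absIntegersToLocal`, `primeBelow`, `primeBelow_mem_primesAbove`);
`Sha` (`closureEmb`, `resGalOfEmb`, `pointsMapOfEmb(_injective/_smul)`,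
`apply_resGalAuxOfEmb_apply`);
`VariableChangePointsMap` (`pointEquivBaseChange(_map_algEquiv)`); `IntegralGaloisActionProofs`
(`exists_isArithFrobAt_of_isInvariant_of_profinite`, `absIntegers.isInvariant/continuousSMul`,
`exists_smul_eq_of_mem_primesAbove_holds`); `IntegralGaloisAction`
(`card_quotient_under_eq_residueCard`); `GoodReductionUnramifiedProofs`
(`galoisRepTate_eq_one_of_mem_inertia`); `GaloisActionProofs` (`card_torsionPoints_eq_sq_holds`);
`TateModule` (`mk`, `proj`, `ext`, `proj_smul`, `proj_smul_of_distribMulAction`);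
`HasseWeilGoodReductionFrobenius` (`isElliptic_reductionAt`, `natCast_residueField_ne_zero`,
`natCard_residueField_eq_residueCard`, `…_of_conj`, `…_of_facts`); `FrobeniusTateModuleProofs`
(`trace_galoisRepTate_frobenius_of_exists_weilPairing`); `FrobeniusSeparableProofs`
(`isSeparable_oneSubFrobeniusIsogeny_holds`); `AdicCompletionResidueField`
(`finite_residueField_adicCompletionIntegers`).

## Design

No definitions (theorems only; the intermediate objects — residue map, reduction map on
torsion, `T_ℓ`-isomorphism — are produced existentially with their properties).
`noncomputable section`, `open scoped Classical NNReal Pointwise`, one universe `u` (`K : Type u`,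
as in `Sha`/`SelmerInertia`); §1 in Mathlib's `IsDedekindDomain.HeightOneSpectrum` namespace
(next to `localAbsIntegers`), §2 in `namespace Literature` / `Literature.NumberTheory.EllipticCurves.TateModule`, §3–§5 deliberate
dot-notation extensions of `WeierstrassCurve`.  Axioms of every theorem: `propext`,
`Classical.choice`, `Quot.sound`.
-/

noncomputable section

open scoped Classical NNReal Pointwise
open NumberField IsDedekindDomain Polynomial WeierstrassCurve

universe u

/-! ## Local Frobenius elements and the residue map of `K̄_v` -/

namespace IsDedekindDomain.HeightOneSpectrum

open Literature.NumberTheory.EllipticCurves Literature.NumberTheory.GaloisRepresentations Field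

variable {K : Type u} [Field K] [NumberField K] (v : HeightOneSpectrum (𝓞 K))

/-- A prime `𝔐` of `\bar 𝓞_v` above `𝓂_v` lies over `𝓂_v`: `𝔐 ∩ 𝓞_v = 𝓂_v`. [folklore] -/
theorem under_eq_maximalIdeal_of_mem_localPrimesAbove {𝔐 : Ideal (localAbsIntegers v)}
    (h𝔐 : 𝔐 ∈ v.localPrimesAbove) :
    𝔐.under (v.adicCompletionIntegers K) = IsLocalRing.maximalIdeal (v.adicCompletionIntegers K) :=
  (h𝔐.2.over).symm

/-- `#(𝓞_v ⧸ (𝔐 ∩ 𝓞_v)) = #k_v` for a prime `𝔐` of `\bar 𝓞_v` above `𝓂_v`. [folklore] -/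
theorem natCard_quotient_under_eq_of_mem_localPrimesAbove {𝔐 : Ideal (localAbsIntegers v)}
    (h𝔐 : 𝔐 ∈ v.localPrimesAbove) :
    Nat.card (v.adicCompletionIntegers K ⧸ 𝔐.under (v.adicCompletionIntegers K)) =
      Nat.card (IsLocalRing.ResidueField (v.adicCompletionIntegers K)) := by
  rw [under_eq_maximalIdeal_of_mem_localPrimesAbove v h𝔐]
  rfl

/-- **Local Frobenius elements exist**: for a prime `𝔐` of the local absolute integers
`\bar 𝓞_v ⊆ K̄_v` above `𝓂_v` there is `σ ∈ Γ_{K_v} = Gal(K̄_v/K_v)` with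
`σ b ≡ b ^ {#k_v} (mod 𝔐)` for all `b ∈ \bar 𝓞_v` (Mathlib `IsArithFrobAt`), i.e. inducing the
`q_v`-power Frobenius on the residue field `\bar 𝓞_v / 𝔐 ⊇ k_v`.  This is the surjectivity of
`Γ_{K_v} → Gal(k̄_v/k_v)` (Neukirch, *ANT*, Ch. II (9.9): `1 → I → G → G(λ|κ) → 1` for the
henselian field `K_v`; Serre, *Local Fields*, Ch. I §7 Prop. 20), obtained here from the tree's
profinite existence theorem `Literature.NumberTheory.GaloisRepresentations.exists_isArithFrobAt_of_isInvariant_of_profinite`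
(`IntegralGaloisActionProofs`) applied to `Γ_{K_v}` acting on `\bar 𝓞_v` with invariants `𝓞_v`.
[cite: NeukirchANT1999, Ch. II §9 Prop. (9.9) (exactness at G(λ|κ))] -/
theorem exists_isArithFrobAt_localAbsIntegers {𝔐 : Ideal (localAbsIntegers v)}
    (h𝔐 : 𝔐 ∈ v.localPrimesAbove) :
    ∃ σ : absoluteGaloisGroup (v.adicCompletion K),
      IsArithFrobAt (v.adicCompletionIntegers K) σ 𝔐 := by
  haveI : CharZero (v.adicCompletion K) :=
    charZero_of_injective_algebraMap (algebraMap K (v.adicCompletion K)).injective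
  letI : TopologicalSpace (localAbsIntegers v) := ⊥
  haveI : DiscreteTopology (localAbsIntegers v) := ⟨rfl⟩
  haveI := absIntegers.continuousSMul (v.adicCompletionIntegers K) (K := v.adicCompletion K)
  haveI := absIntegers.isInvariant (v.adicCompletionIntegers K) (K := v.adicCompletion K)
  haveI := h𝔐.1
  haveI : 𝔐.IsMaximal := Ideal.isMaximal_of_isIntegral_of_isMaximal_comap
    (R := v.adicCompletionIntegers K) 𝔐
    (by rw [← Ideal.under_def, under_eq_maximalIdeal_of_mem_localPrimesAbove v h𝔐]
        exact IsLocalRing.maximalIdeal.isMaximal _)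
  haveI : Finite (v.adicCompletionIntegers K ⧸ 𝔐.under (v.adicCompletionIntegers K)) := by
    rw [under_eq_maximalIdeal_of_mem_localPrimesAbove v h𝔐]
    exact finite_residueField_adicCompletionIntegers K v
  exact exists_isArithFrobAt_of_isInvariant_of_profinite 𝔐


section ResidueMap

variable {v} {w : Valuation (AlgebraicClosure (v.adicCompletion K)) ℝ≥0}
  (hw : ∀ x, (w x : ℝ) =
    spectralNorm (v.adicCompletion K) (AlgebraicClosure (v.adicCompletion K)) x)
include hw

/-- **The residue map of `K̄_v` into `k̄_v`.**  For the spectral valuation `w = |·|_v` on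
`K̄_v` and a prime `𝔐` of `\bar 𝓞_v = 𝒪_w` above `𝓂_v`, there is a ring homomorphism
`r : 𝒪_w → k̄_v = AlgebraicClosure k_v` with kernel `𝔐 = {w < 1}` (the residue map
`𝒪_w → 𝒪_w/𝔐` followed by a `k_v`-embedding of the algebraic extension `𝒪_w/𝔐 ⊇ k_v` into
`k̄_v`), compatible with the residue map `𝓞_v → k_v`, and carrying an arithmetic Frobenius
`σ ∈ Γ_{K_v}` at `𝔐` to the `q_v`-power map: `r (σ z) = (r z) ^ {q_v}`.
Neukirch, *ANT*, Ch. II §4 (4.8), §6 (6.2), §9 (9.9) (the residue field extension `λ ⊇ κ` of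
`K̄_v ⊇ K_v` and the map `G → G(λ|κ)`). [folklore] -/
theorem exists_residueMap {𝔐 : Ideal (localAbsIntegers v)} (h𝔐 : 𝔐 ∈ v.localPrimesAbove) :
    ∃ r : w.integer →+* AlgebraicClosure (IsLocalRing.ResidueField (v.adicCompletionIntegers K)),
      (∀ a : w.integer, r a = 0 ↔ w (a : AlgebraicClosure (v.adicCompletion K)) < 1) ∧
      (∀ (a : v.adicCompletionIntegers K)
          (h : w (algebraMap (v.adicCompletion K) (AlgebraicClosure (v.adicCompletion K))
            (algebraMap (v.adicCompletionIntegers K) (v.adicCompletion K) a)) ≤ 1),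
        r ⟨_, h⟩ = algebraMap (IsLocalRing.ResidueField (v.adicCompletionIntegers K)) _
          (IsLocalRing.residue (v.adicCompletionIntegers K) a)) ∧
      (∀ {σ : absoluteGaloisGroup (v.adicCompletion K)},
        IsArithFrobAt (v.adicCompletionIntegers K) σ 𝔐 →
        ∀ (z : w.integer) (h : w (σ • (z : AlgebraicClosure (v.adicCompletion K))) ≤ 1),
          r ⟨σ • (z : AlgebraicClosure (v.adicCompletion K)), h⟩ =
            r z ^ Nat.card (IsLocalRing.ResidueField (v.adicCompletionIntegers K))) := by
  haveI := h𝔐.1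
  -- notation
  set O := v.adicCompletionIntegers K with hO
  set L := AlgebraicClosure (v.adicCompletion K) with hL
  -- `𝒪_w = \bar 𝓞_v` (Neukirch II (6.2)): the identity map on elements
  let e : w.integer →+* localAbsIntegers v :=
    { toFun := fun a ↦ ⟨a, (mem_localAbsIntegers_iff_spectralValuation hw).mpr a.2⟩
      map_one' := Subtype.ext rfl
      map_mul' := fun _ _ ↦ Subtype.ext rfl
      map_zero' := Subtype.ext rfl
      map_add' := fun _ _ ↦ Subtype.ext rfl }
  have he : ∀ a : w.integer, (e a : L) = a := fun _ ↦ rfl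
  -- the residue field extension `\bar 𝓞_v / 𝔐 ⊇ k_v`
  have hle : IsLocalRing.maximalIdeal O ≤ 𝔐.comap (algebraMap O (localAbsIntegers v)) := by
    rw [← Ideal.under_def, under_eq_maximalIdeal_of_mem_localPrimesAbove v h𝔐]
  letI algKB : Algebra (IsLocalRing.ResidueField O) (localAbsIntegers v ⧸ 𝔐) :=
    Ideal.Quotient.algebraQuotientOfLEComap hle
  haveI : IsScalarTower O (IsLocalRing.ResidueField O) (localAbsIntegers v ⧸ 𝔐) :=
    IsScalarTower.of_algebraMap_eq fun _ ↦ rfl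
  haveI : Algebra.IsAlgebraic (IsLocalRing.ResidueField O) (localAbsIntegers v ⧸ 𝔐) := by
    refine ⟨fun x ↦ ?_⟩
    obtain ⟨b, rfl⟩ := Ideal.Quotient.mk_surjective x
    have hb : IsIntegral O b := Algebra.IsIntegral.isIntegral b
    exact ((hb.map (Ideal.Quotient.mkₐ O 𝔐)).tower_top
      (A := IsLocalRing.ResidueField O)).isAlgebraic
  haveI : Module.IsTorsionFree (IsLocalRing.ResidueField O) (localAbsIntegers v ⧸ 𝔐) :=
    DivisionSemiring.to_moduleIsTorsionFree
  haveI : Module.IsTorsionFree (IsLocalRing.ResidueField O)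
      (AlgebraicClosure (IsLocalRing.ResidueField O)) :=
    DivisionSemiring.to_moduleIsTorsionFree
  let j : (localAbsIntegers v ⧸ 𝔐) →ₐ[IsLocalRing.ResidueField O]
      AlgebraicClosure (IsLocalRing.ResidueField O) := IsAlgClosed.lift
  -- `j` is injective (its source is a field)
  have hfield : IsField (localAbsIntegers v ⧸ 𝔐) :=
    (Ideal.Quotient.maximal_ideal_iff_isField_quotient 𝔐).mp (by
      exact Ideal.isMaximal_of_isIntegral_of_isMaximal_comap (R := O) 𝔐
        (by rw [← Ideal.under_def, under_eq_maximalIdeal_of_mem_localPrimesAbove v h𝔐]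
            exact IsLocalRing.maximalIdeal.isMaximal _))
  have hj : ∀ x, j x = 0 ↔ x = 0 := by
    intro x
    refine ⟨fun hx ↦ ?_, fun hx ↦ by rw [hx, map_zero]⟩
    by_contra hx0
    obtain ⟨y, hxy⟩ := hfield.mul_inv_cancel hx0
    have := congrArg j hxy
    rw [map_mul, hx, zero_mul, map_one] at this
    exact zero_ne_one this
  refine ⟨j.toRingHom.comp ((Ideal.Quotient.mk 𝔐).comp e), fun a ↦ ?_, fun a h ↦ ?_,
    fun {σ} hσ z h ↦ ?_⟩
  · change j (Ideal.Quotient.mk 𝔐 (e a)) = 0 ↔ _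
    rw [hj, Ideal.Quotient.eq_zero_iff_mem, mem_iff_spectralValuation_lt_one hw h𝔐, he]
  · change j (Ideal.Quotient.mk 𝔐 (e _)) = _
    have h1 : e ⟨_, h⟩ = algebraMap O (localAbsIntegers v) a := by
      refine Subtype.ext ?_
      rw [he, Subalgebra.coe_algebraMap, IsScalarTower.algebraMap_apply O (v.adicCompletion K) L]
    rw [h1, ← Ideal.Quotient.algebraMap_eq, ← IsScalarTower.algebraMap_apply,
      IsScalarTower.algebraMap_apply O (IsLocalRing.ResidueField O) (localAbsIntegers v ⧸ 𝔐),
      AlgHom.commutes]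
    rfl
  · change j (Ideal.Quotient.mk 𝔐 (e _)) = j (Ideal.Quotient.mk 𝔐 (e z)) ^ _
    have h1 : e ⟨σ • (z : L), h⟩ = σ • e z := Subtype.ext (by rw [integralClosure.coe_smul]; rfl)
    have h2 : Ideal.Quotient.mk 𝔐 (σ • e z) =
        Ideal.Quotient.mk 𝔐 (e z) ^ Nat.card (O ⧸ 𝔐.under O) := by
      rw [← map_pow]
      exact Ideal.Quotient.eq.mpr (hσ (e z))
    rw [h1, h2, map_pow, natCard_quotient_under_eq_of_mem_localPrimesAbove v h𝔐]

end ResidueMap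

end IsDedekindDomain.HeightOneSpectrum

/-! ## Two algebraic lemmas: counting torsion, and Tate modules from the primary torsion -/

namespace Literature.NumberTheory.EllipticCurves

/-- **Injective + equal counts ⇒ bijective on `pⁿ`-torsion.**  Let `f : A[p^∞] → B` be an
injective homomorphism on the `p`-primary torsion and suppose `#B[pⁿ] ≤ #A[pⁿ] < ∞`.  Then
every `pⁿ`-torsion element of `B` is `f a` for a (unique) `pⁿ`-torsion `a`.  (Diamond–Shurman,
proof of Thm. 9.4.1: an injection `E[ℓⁿ] → Ẽ[ℓⁿ]` between groups of the same order `ℓ²ⁿ` is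
an isomorphism.) [folklore] -/
theorem exists_eq_of_injective_of_card_torsionBy_le {A B : Type*} [AddCommGroup A]
    [AddCommGroup B] {p : ℕ} (f : AddCommGroup.primaryComponent A p →+ B)
    (hf : Function.Injective f) {n : ℕ} [Finite (AddSubgroup.torsionBy B (p ^ n : ℕ))]
    (hcard : Nat.card (AddSubgroup.torsionBy B (p ^ n : ℕ)) ≤
      Nat.card (AddSubgroup.torsionBy A (p ^ n : ℕ)))
    {b : B} (hb : p ^ n • b = 0) :
    ∃ a : AddCommGroup.primaryComponent A p, p ^ n • a = 0 ∧ f a = b := by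
  -- the induced map `A[pⁿ] → B[pⁿ]`
  let ι : AddSubgroup.torsionBy A (p ^ n : ℕ) → AddCommGroup.primaryComponent A p :=
    fun a ↦ ⟨a, n, AddSubgroup.torsionBy.nsmul_iff.mp a.2⟩
  have hι : ∀ a, p ^ n • ι a = 0 := fun a ↦
    Subtype.ext (AddSubgroup.torsionBy.nsmul_iff.mp a.2)
  let g : AddSubgroup.torsionBy A (p ^ n : ℕ) → AddSubgroup.torsionBy B (p ^ n : ℕ) :=
    fun a ↦ ⟨f (ι a), AddSubgroup.torsionBy.nsmul_iff.mpr (by rw [← map_nsmul, hι, map_zero])⟩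
  have hg : Function.Injective g := by
    intro a a' h
    have h1 : f (ι a) = f (ι a') := congrArg Subtype.val h
    have h2 := congrArg Subtype.val (hf h1)
    exact Subtype.ext h2
  obtain ⟨a, ha⟩ :=
    (hg.bijective_of_nat_card_le hcard).2 ⟨b, AddSubgroup.torsionBy.nsmul_iff.mpr hb⟩
  exact ⟨ι a, hι a, congrArg Subtype.val ha⟩

namespace TateModule

variable {A : Type u} {B : Type*} [AddCommGroup A] [AddCommGroup B] {p : ℕ} [Fact p.Prime]

omit [Fact p.Prime] in
/-- The components of an element of `T_p A` lie in the `p`-primary torsion `A[p^∞]`. [folklore] -/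
theorem proj_mem_primaryComponent (n : ℕ) (a : TateModule A p) :
    proj p n a ∈ AddCommGroup.primaryComponent A p :=
  ⟨n, pow_smul_proj n a⟩

/-- **`T_p` from the `p`-primary torsion.**  An injective homomorphism `f : A[p^∞] → B`
which hits every `pⁿ`-torsion element of `B` with a `pⁿ`-torsion element of `A[p^∞]` (for all
`n`) induces a `ℤ_p`-linear isomorphism `e : T_p A ≃ T_p B`, `(a_n)_n ↦ (f a_n)_n`.  (The
passage "to the inverse limit" in the proof of Diamond–Shurman Thm. 9.4.1 / Silverman VII.4.1,
`T_ℓ(E) ≅ T_ℓ(Ẽ)` from `E[ℓⁿ] ≅ Ẽ[ℓⁿ]` for all `n`.) [folklore] -/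
theorem exists_linearEquiv_of_primaryComponent (f : AddCommGroup.primaryComponent A p →+ B)
    (hf : Function.Injective f)
    (hsurj : ∀ (n : ℕ) (b : B), p ^ n • b = 0 →
      ∃ a : AddCommGroup.primaryComponent A p, p ^ n • a = 0 ∧ f a = b) :
    ∃ e : TateModule A p ≃ₗ[ℤ_[p]] TateModule B p,
      ∀ (a : TateModule A p) (n : ℕ),
        proj p n (e a) = f ⟨proj p n a, proj_mem_primaryComponent n a⟩ := by
  -- the linear map
  let e₀ : TateModule A p →ₗ[ℤ_[p]] TateModule B p :=
    { toFun := fun a ↦ mk (fun n ↦ f ⟨proj p n a, proj_mem_primaryComponent n a⟩)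
        (fun n ↦ by
          rw [← map_nsmul, ← map_zero f]
          congr 1
          exact Subtype.ext (pow_smul_proj n a))
        (fun n ↦ by
          rw [← map_nsmul]
          congr 1
          exact Subtype.ext (smul_proj_succ n a))
      map_add' := fun a b ↦ TateModule.ext fun n ↦ by
        simp only [proj_mk, map_add]
        exact map_add f ⟨proj p n a, proj_mem_primaryComponent n a⟩
          ⟨proj p n b, proj_mem_primaryComponent n b⟩
      map_smul' := fun x a ↦ TateModule.ext fun n ↦ by
        simp only [proj_mk, proj_smul, RingHom.id_apply]
        exact map_nsmul f _ ⟨proj p n a, proj_mem_primaryComponent n a⟩ }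
  have he₀ : ∀ a n, proj p n (e₀ a) = f ⟨proj p n a, proj_mem_primaryComponent n a⟩ :=
    fun _ _ ↦ rfl
  have hinj : Function.Injective e₀ := by
    rw [injective_iff_map_eq_zero]
    intro a ha
    refine TateModule.ext fun n ↦ ?_
    have h := congrArg (proj p n) ha
    rw [he₀, map_zero, ← map_zero f] at h
    exact congrArg Subtype.val (hf h)
  have hsurj' : Function.Surjective e₀ := by
    intro b
    choose a ha hfa using fun n ↦ hsurj n (proj p n b) (pow_smul_proj n b)
    have hcompat : ∀ n, p • (a (n + 1) : A) = a n := fun n ↦ by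
      have : f (p • a (n + 1)) = f (a n) := by
        rw [map_nsmul, hfa, hfa, smul_proj_succ]
      exact congrArg Subtype.val (hf this)
    refine ⟨mk (fun n ↦ (a n : A)) (fun n ↦ congrArg Subtype.val (ha n)) hcompat,
      TateModule.ext fun n ↦ ?_⟩
    rw [he₀, ← hfa n]
    rfl
  exact ⟨LinearEquiv.ofBijective e₀ ⟨hinj, hsurj'⟩, fun a n ↦ he₀ a n⟩

end TateModule

end Literature.NumberTheory.EllipticCurves

/-! ## The reduction homomorphism on `ℓ`-primary torsion -/

namespace WeierstrassCurve

open Literature.NumberTheory.EllipticCurves Literature.NumberTheory.GaloisRepresentations Field IsDedekindDomain.HeightOneSpectrum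

variable {K : Type u} [Field K] [NumberField K] (W : WeierstrassCurve K)
  (v : HeightOneSpectrum (𝓞 K))

/-- The chosen minimal model at `v` is `W_{K_v}` up to the chosen change of variables:
`C • W_{K_v} = M_{K_v}` with `M = W.localMinimalIntegralModel v` over `𝓞_v` (Mathlib
`WeierstrassCurve.minimal`, `integralModel`). Silverman, *AEC*, VII.§1. [folklore] -/
theorem exists_variableChange_eq_localMinimalIntegralModel :
    ∃ C : VariableChange (v.adicCompletion K),
      C • W.baseChange (v.adicCompletion K) =
        (W.localMinimalIntegralModel v).map
          (algebraMap (v.adicCompletionIntegers K) (v.adicCompletion K)) :=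
  ⟨((W.baseChange (v.adicCompletion K)).exists_isMinimal (v.adicCompletionIntegers K)).choose,
    (baseChange_integralModel_eq (v.adicCompletionIntegers K) (W.localMinimalModel v)).symm⟩

variable {W v} in
/-- At a place of good reduction the chosen minimal integral model has unit discriminant.
Silverman, *AEC*, VII.5.1(a). [folklore] -/
theorem isUnit_Δ_localMinimalIntegralModel (hv : W.HasGoodReductionAt v) :
    IsUnit (W.localMinimalIntegralModel v).Δ := by
  have hu := (isElliptic_reductionAt hv).isUnit
  rw [reductionAt, reduction, map_Δ] at hu
  exact (isUnit_map_iff (IsLocalRing.residue _) _).mp hu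

/-- `Ẽ_v` is the coefficientwise residue of the chosen minimal integral model. [folklore] -/
theorem reductionAt_eq_map_residue :
    W.reductionAt v =
      (W.localMinimalIntegralModel v).map (IsLocalRing.residue (v.adicCompletionIntegers K)) :=
  rfl

variable {W v}

omit [NumberField K] in
/-- `v ∤ ℓ` implies `v ∤ ℓⁿ`. [folklore] -/
theorem pow_natCast_not_mem {ℓ : ℕ} (hℓ : (ℓ : 𝓞 K) ∉ v.asIdeal) (n : ℕ) :
    (((ℓ ^ n : ℕ) : ℤ) : 𝓞 K) ∉ v.asIdeal := by
  intro h
  apply hℓ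
  have : (((ℓ ^ n : ℕ) : ℤ) : 𝓞 K) = (ℓ : 𝓞 K) ^ n := by push_cast; rfl
  rw [this] at h
  exact v.isPrime.mem_of_pow_mem n h

/-- **The reduction map on `ℓ`-primary torsion, `E(K̄)[ℓ^∞] → Ẽ_v(k̄_v)`, along an embedding
`ι : K̄ → K̄_v`** (Silverman, *AEC*, VII.§2–§3; Diamond–Shurman, proof of Thm. 9.4.1: "the
reduction preserves `ℓⁿ`-torsion structure").  Let `E/K` be an elliptic curve over a number
field, `v ∤ ℓ` a place of good reduction, `𝔐` a prime of `\bar 𝓞_v` above `𝓂_v`, `σ ∈ Γ_{K_v}`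
an arithmetic Frobenius at `𝔐` and `φ ∈ Γ_{k_v}` the `q_v`-power Frobenius.  Then there is an
injective homomorphism `f : E(K̄)[ℓ^∞] → Ẽ_v(k̄_v)` with `f (σ|_{K̄} • P) = φ • f P`, where
`σ|_{K̄} = resGalOfEmb ι σ ∈ Γ_K`.  Construction: `P ↦` (reduction modulo `𝔐` of the
`w`-integral point `C • ι(P)` of the good model `M_{K̄_v}`, `M = W.localMinimalIntegralModel v`,
`C` over `K_v`), using `Literature.NumberTheory.EllipticCurves.reduceHom` (file `PointReduction`: VII.2.1 on prime-to-`p` torsion,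
injective by VII.3.1(b)); equivariance because `C` has coefficients in `K_v` and the residue
map carries `σ` to `x ↦ x ^ {q_v}`.
[cite: SilvermanAEC2009, Prop. VII.3.1(b) with Prop. VII.2.1]
[cite: DiamondShurman2005, Thm. 9.4.1 (proof)] -/
theorem exists_reduceTorsionHom [W.IsElliptic] {ℓ : ℕ} [Fact ℓ.Prime]
    (hℓ : (ℓ : 𝓞 K) ∉ v.asIdeal) (hv : W.HasGoodReductionAt v)
    {𝔐 : Ideal (localAbsIntegers v)} (h𝔐 : 𝔐 ∈ v.localPrimesAbove)
    (ι : AlgebraicClosure K →ₐ[K] AlgebraicClosure (v.adicCompletion K))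
    {σ : absoluteGaloisGroup (v.adicCompletion K)}
    (hσ : IsArithFrobAt (v.adicCompletionIntegers K) σ 𝔐)
    {φ : absoluteGaloisGroup (IsLocalRing.ResidueField (v.adicCompletionIntegers K))}
    (hφ : ∀ x : AlgebraicClosure (IsLocalRing.ResidueField (v.adicCompletionIntegers K)),
      φ • x = x ^ Nat.card (IsLocalRing.ResidueField (v.adicCompletionIntegers K))) :
    ∃ f : geomPrimaryTorsion W ℓ →+ geomPoints (W.reductionAt v),
      Function.Injective f ∧
      ∀ P : geomPrimaryTorsion W ℓ, f (resGalOfEmb ι σ • P) = φ • f P := by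
  obtain ⟨w, hw⟩ := v.exists_spectralValuation
  obtain ⟨r, hr, hrO, hrσ⟩ := exists_residueMap hw h𝔐
  obtain ⟨C, hC⟩ := W.exists_variableChange_eq_localMinimalIntegralModel v
  -- notation (`O = 𝓞_v`, `E = K_v`, `L = K̄_v`, `k = k_v`, `M` the minimal integral model)
  let O := v.adicCompletionIntegers K
  let E := v.adicCompletion K
  let L := AlgebraicClosure (v.adicCompletion K)
  let k := IsLocalRing.ResidueField (v.adicCompletionIntegers K)
  let M : WeierstrassCurve O := W.localMinimalIntegralModel v
  set V : WeierstrassCurve L := (M.map (algebraMap O E)).baseChange L with hVdef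
  set σE : L ≃ₐ[E] L := absoluteGaloisGroup.toAlgEquiv _ σ with hσE
  set φk : AlgebraicClosure k ≃ₐ[k] AlgebraicClosure k := absoluteGaloisGroup.toAlgEquiv _ φ
    with hφk
  haveI hVint : V.IsIntegral w.integer := isIntegral_spectralValuation_baseChange hw M
  have hΔ : w V.Δ = 1 := spectralValuation_Δ_baseChange hw (isUnit_Δ_localMinimalIntegralModel hv)
  -- the reduced equation is `Ẽ_v ⊗ k̄_v`
  set Vt : WeierstrassCurve (AlgebraicClosure k) :=
    (W.reductionAt v).baseChange (AlgebraicClosure k) with hVtdef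
  have hcoef : ∀ a : O, reduceFun r (algebraMap E L (algebraMap O E a)) =
      algebraMap k (AlgebraicClosure k) (IsLocalRing.residue O a) := fun a ↦ by
    have h : w (algebraMap E L (algebraMap O E a)) ≤ 1 :=
      (spectralValuation_algebraMap_le_one_iff hw _).mpr a.2
    rw [reduceFun_of_le r h]
    exact hrO a h
  have hVt : reduceCurve r V = Vt :=
    WeierstrassCurve.ext (hcoef M.a₁) (hcoef M.a₂) (hcoef M.a₃) (hcoef M.a₄) (hcoef M.a₆)
  -- transport `E(K̄) → E(K̄_v) → M(K̄_v)`
  have hC' := congrArg (fun X : WeierstrassCurve E ↦ X.baseChange L) hC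
  let Φ : geomPoints W →+ V.toAffine.Point :=
    ((((Affine.Point.congrEquiv hC').toAddMonoidHom.comp
      (VariableChange.pointEquivBaseChange (W.baseChange E) C L).toAddMonoidHom).comp
      (Affine.Point.congrEquiv (baseChange_baseChange_adicCompletion W v).symm).toAddMonoidHom).comp
      (pointsMapOfEmb W ι))
  have hΦapply : ∀ P : geomPoints W, Φ P = Affine.Point.congrEquiv hC'
      (VariableChange.pointEquivBaseChange (W.baseChange E) C L
        (Affine.Point.congrEquiv (baseChange_baseChange_adicCompletion W v).symm
          (pointsMapOfEmb W ι P))) := fun _ ↦ rfl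
  have hΦinj : Function.Injective Φ := by
    intro P Q h
    rw [hΦapply, hΦapply] at h
    exact pointsMapOfEmb_injective W ι ((Affine.Point.congrEquiv _).injective
      ((VariableChange.pointEquivBaseChange _ _ _).injective
        ((Affine.Point.congrEquiv _).injective h)))
  have hΦσ : ∀ P : geomPoints W,
      Φ (resGalOfEmb ι σ • P) = Affine.Point.map (σE : L →ₐ[E] L) (Φ P) := fun P ↦ by
    rw [hΦapply, hΦapply, pointsMapOfEmb_smul, congrEquiv_smul,
      VariableChange.pointEquivBaseChange_map_algEquiv, hσE]
    exact Affine.Point.congrEquiv_baseChange_map hC _ _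
  -- `ℓ`-primary torsion lands in the prime-to-`p` torsion of `M(K̄_v)`
  have hgood : ∀ P : geomPrimaryTorsion W ℓ, Φ P ∈ goodTorsion w V := fun P ↦ by
    obtain ⟨n, hn⟩ := P.2
    refine ⟨(ℓ ^ n : ℕ), spectralValuation_intCast_eq_one hw (pow_natCast_not_mem hℓ n), ?_⟩
    rw [natCast_zsmul, ← map_nsmul, hn, map_zero]
  let Ψ : geomPrimaryTorsion W ℓ →+ goodTorsion w V :=
    AddMonoidHom.codRestrict (Φ.comp (geomPrimaryTorsion W ℓ).subtype) (goodTorsion w V) hgood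
  have hΨ : ∀ P, (Ψ P : V.toAffine.Point) = Φ P := fun _ ↦ rfl
  -- reduction modulo `𝔐` intertwines `σ` with `φ`
  have hred : ∀ Q : V.toAffine.Point, IsIntegralPoint w Q →
      reducePoint w r Vt (Affine.Point.map (σE : L →ₐ[E] L) Q) =
        (show geomPoints (W.reductionAt v) → geomPoints (W.reductionAt v) from (φ • ·))
          (reducePoint w r Vt Q) := by
    intro Q hQ
    change _ = Affine.Point.map (φk : AlgebraicClosure k →ₐ[k] AlgebraicClosure k)
      (reducePoint w r Vt Q)
    set σ' : L →ₐ[E] L := (σE : L →ₐ[E] L) with hσ'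
    have hσw : ∀ z, w (σ' z) = w z := fun z ↦ spectralValuation_smul hw σ z
    rcases Q with _ | ⟨x, y, h⟩
    · rfl
    · have hx : w x ≤ 1 := hQ
      have hy : w y ≤ 1 := val_y_le_one h.1 hx
      have hσx : w (σ' x) ≤ 1 := (hσw x).le.trans hx
      have hσy : w (σ' y) ≤ 1 := (hσw y).le.trans hy
      rw [Affine.Point.map_some, reducePoint_some hr hΔ hVt _ hσx,
        reducePoint_some hr hΔ hVt h hx, Affine.Point.map_some]
      refine point_some_eq_some ?_ ?_
      · rw [reduceFun_of_le r hσx, reduceFun_of_le r hx]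
        exact (hrσ hσ ⟨x, hx⟩ hσx).trans (hφ _).symm
      · rw [reduceFun_of_le r hσy, reduceFun_of_le r hy]
        exact (hrσ hσ ⟨y, hy⟩ hσy).trans (hφ _).symm
  refine ⟨show geomPrimaryTorsion W ℓ →+ geomPoints (W.reductionAt v) from
      (reduceHom w r hr hΔ hVt).comp Ψ, ?_, fun P ↦ ?_⟩
  · exact (injective_reduceHom hr hΔ hVt).comp fun P Q h ↦
      Subtype.ext (hΦinj (by rw [← hΨ P, ← hΨ Q, h]))
  · change reducePoint w r Vt (Φ ((resGalOfEmb ι σ • P : geomPrimaryTorsion W ℓ) : geomPoints W)) =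
      (show geomPoints (W.reductionAt v) → geomPoints (W.reductionAt v) from (φ • ·))
        (reducePoint w r Vt (Φ P))
    rw [primaryComponent.coe_smul, hΦσ]
    exact hred _ (isIntegralPoint_of_mem_goodTorsion (hgood P))


/-- **The restriction of a local Frobenius is a global Frobenius**: if `σ ∈ Γ_{K_v}` is an
arithmetic Frobenius at the prime `𝔐` of `\bar 𝓞_v`, then its restriction `σ|_{K̄} ∈ Γ_K`
along `ι : K̄ → K̄_v` is an arithmetic Frobenius at the prime `𝔓_{ι,𝔐} = ι⁻¹(𝔐) ∩ \bar ℤ_K`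
(same residue characteristic power `N v = #k_v`).  Neukirch, *ANT*, Ch. II (9.6) (the easy
inclusion `G(L_w|K_v) → G_w(L|K)` compatible with the maps to `G(λ|κ)`). [folklore] -/
theorem isArithFrobAt_resGalOfEmb {𝔐 : Ideal (localAbsIntegers v)} (h𝔐 : 𝔐 ∈ v.localPrimesAbove)
    (ι : AlgebraicClosure K →ₐ[K] AlgebraicClosure (v.adicCompletion K))
    {σ : absoluteGaloisGroup (v.adicCompletion K)}
    (hσ : IsArithFrobAt (v.adicCompletionIntegers K) σ 𝔐) :
    IsArithFrobAt (𝓞 K) (resGalOfEmb ι σ) (v.primeBelow ι 𝔐) := by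
  have h𝔓₀ : v.primeBelow ι 𝔐 ∈ v.primesAbove := primeBelow_mem_primesAbove h𝔐
  intro b
  rw [card_quotient_under_eq_residueCard h𝔓₀, ← natCard_residueField_eq_residueCard v,
    ← natCard_quotient_under_eq_of_mem_localPrimesAbove v h𝔐, mem_primeBelow_iff, map_sub, map_pow]
  have key := hσ (absIntegersToLocal v ι b)
  have h1 : absIntegersToLocal v ι (MulSemiringAction.toAlgHom (𝓞 K) _ (resGalOfEmb ι σ) b) =
      σ • absIntegersToLocal v ι b := by
    refine Subtype.ext ?_
    rw [coe_absIntegersToLocal_apply, integralClosure.coe_smul, MulSemiringAction.toAlgHom_apply,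
      integralClosure.coe_smul, coe_absIntegersToLocal_apply]
    exact apply_resGalAuxOfEmb_apply ι σ b
  rw [h1]
  exact key

/-- **Silverman AEC C.21 Remark 21.3 / Diamond–Shurman Thm. 9.4.1 (mechanism) — discharge of
the named fact `WeierstrassCurve.galoisRepTate_frobenius_conj_reductionAt`.**  For an elliptic
curve `E/K` over a number field, `v ∤ ℓ` a finite place of good reduction, `𝔓 ∣ v`,
`σ ∈ Gal(K̄/K)` an arithmetic Frobenius at `𝔓` and `φ ∈ Γ_{k_v}` the `q_v`-power Frobenius,
there is a `ℤ_ℓ`-linear isomorphism `e : T_ℓ E ≃ T_ℓ Ẽ_v` with `e ∘ ρ_{E,ℓ}(σ) = ρ_{Ẽ_v,ℓ}(φ) ∘ e`.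
Proof (as printed, Diamond–Shurman pp. 383–384 / Silverman VII.4.1, at the completion):
choose a prime `𝔐` of `\bar 𝓞_v`, an embedding `ι : K̄ → K̄_v` and a *local* Frobenius
`σ_v ∈ Γ_{K_v}` at `𝔐` (`exists_isArithFrobAt_localAbsIntegers`); the reduction map on
`ℓ`-primary torsion `E(K̄)[ℓ^∞] → Ẽ_v(k̄_v)` along `ι` (`exists_reduceTorsionHom`: VII.2.1,
VII.3.1(b)) is injective, `σ_v|_{K̄} ↦ φ`-equivariant, and bijective on each `E[ℓⁿ] → Ẽ_v[ℓⁿ]`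
by counting (`#E[ℓⁿ] = ℓ²ⁿ = #Ẽ_v[ℓⁿ]`, Cor. III.6.4(b)); passing to the limit gives `e₀` for
`σ₀ = σ_v|_{K̄}`, an arithmetic Frobenius at `𝔓_{ι,𝔐}`.  For the given `(𝔓, σ)`: `τ 𝔓_{ι,𝔐} = 𝔓`
for some `τ ∈ Γ_K` (transitivity), `τ σ₀ τ⁻¹` is a Frobenius at `𝔓`, `σ (τ σ₀ τ⁻¹)⁻¹` lies in the
inertia group `I_𝔓`, which acts trivially on `T_ℓ E` (VII.4.1(b),
`galoisRepTate_eq_one_of_mem_inertia`), so `ρ(σ) = ρ(τ) ρ(σ₀) ρ(τ)⁻¹` and `e = e₀ ∘ ρ(τ⁻¹)`.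
[cite: DiamondShurman2005, Thm. 9.4.1 (proof)]
[cite: SilvermanAEC2009, Prop. VII.4.1 (proof), Prop. VII.3.1(b), VII.2.1, Cor. III.6.4(b)] -/
theorem galoisRepTate_frobenius_conj_reductionAt_holds {ℓ : ℕ} [Fact ℓ.Prime] :
    W.galoisRepTate_frobenius_conj_reductionAt ℓ := by
  intro _ v hℓ hv 𝔓 h𝔓 σ hσ φ hφ
  -- Step 1: local Frobenius and the reduction map on `ℓ`-primary torsion
  obtain ⟨𝔐, h𝔐⟩ := v.localPrimesAbove_nonempty
  let ι : AlgebraicClosure K →ₐ[K] AlgebraicClosure (v.adicCompletion K) :=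
    closureEmb (K := K) (v.adicCompletion K)
  obtain ⟨σL, hσL⟩ := v.exists_isArithFrobAt_localAbsIntegers h𝔐
  obtain ⟨f, hf, hfσ⟩ := exists_reduceTorsionHom hℓ hv h𝔐 ι hσL hφ
  set σ₀ : absoluteGaloisGroup K := resGalOfEmb ι σL with hσ₀
  -- Step 2: counting, `#E[ℓⁿ] = ℓ²ⁿ = #Ẽ_v[ℓⁿ]`
  haveI := isElliptic_reductionAt hv
  have hsurj : ∀ (n : ℕ) (Q : geomPoints (W.reductionAt v)), ℓ ^ n • Q = 0 →
      ∃ P : geomPrimaryTorsion W ℓ, ℓ ^ n • P = 0 ∧ f P = Q := by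
    intro n Q hQ
    have hA : Nat.card (geomTorsion W (ℓ ^ n : ℕ)) = (ℓ ^ n) ^ 2 :=
      card_torsionPoints_eq_sq_holds W (AlgebraicClosure K)
        (Nat.cast_ne_zero.mpr (pow_ne_zero n (Fact.out : ℓ.Prime).ne_zero))
    have hℓk : ((ℓ ^ n : ℕ) :
        AlgebraicClosure (IsLocalRing.ResidueField (v.adicCompletionIntegers K))) ≠ 0 := by
      rw [← map_natCast (algebraMap (IsLocalRing.ResidueField (v.adicCompletionIntegers K)) _),
        _root_.map_ne_zero, Nat.cast_pow]
      exact pow_ne_zero n (natCast_residueField_ne_zero hℓ)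
    have hB : Nat.card (geomTorsion (W.reductionAt v) (ℓ ^ n : ℕ)) = (ℓ ^ n) ^ 2 :=
      card_torsionPoints_eq_sq_holds (W.reductionAt v) _ hℓk
    haveI : Finite (geomTorsion (W.reductionAt v) (ℓ ^ n : ℕ)) :=
      Nat.finite_of_card_ne_zero
        (by rw [hB]; exact pow_ne_zero _ (pow_ne_zero _ (Fact.out : ℓ.Prime).ne_zero))
    exact exists_eq_of_injective_of_card_torsionBy_le f hf (hB.trans hA.symm).le hQ
  -- Step 3: the isomorphism of Tate modules for `σ₀`
  obtain ⟨e₀, he₀⟩ := TateModule.exists_linearEquiv_of_primaryComponent f hf hsurj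
  have he₀σ : ∀ a : W.tateModule ℓ, e₀ (σ₀ • a) = φ • e₀ a := fun a ↦ TateModule.ext fun n ↦ by
    have h1 : (⟨TateModule.proj ℓ n (σ₀ • a), TateModule.proj_mem_primaryComponent n _⟩ :
        geomPrimaryTorsion W ℓ) =
          σ₀ • ⟨TateModule.proj ℓ n a, TateModule.proj_mem_primaryComponent n a⟩ :=
      Subtype.ext (TateModule.proj_smul_of_distribMulAction σ₀ a n)
    rw [he₀, h1, hfσ, TateModule.proj_smul_of_distribMulAction, he₀]
  -- Step 4: `σ₀` is an arithmetic Frobenius at `𝔓₀ = 𝔓_{ι,𝔐}`; transport to `(𝔓, σ)`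
  have h𝔓₀ : v.primeBelow ι 𝔐 ∈ v.primesAbove := primeBelow_mem_primesAbove h𝔐
  have hσ₀F : IsArithFrobAt (𝓞 K) σ₀ (v.primeBelow ι 𝔐) := isArithFrobAt_resGalOfEmb h𝔐 ι hσL
  obtain ⟨τ, hτ⟩ := exists_smul_eq_of_mem_primesAbove_holds h𝔓₀ h𝔓
  have hγ : IsArithFrobAt (𝓞 K) (τ * σ₀ * τ⁻¹) 𝔓 := hτ ▸ hσ₀F.conj τ
  have hI : σ * (τ * σ₀ * τ⁻¹)⁻¹ ∈ 𝔓.inertia (absoluteGaloisGroup K) := hσ.mul_inv_mem_inertia hγ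
  set ρ := W.galoisRepTate ℓ with hρ
  have hρσ : ρ σ = ρ τ * ρ σ₀ * ρ τ⁻¹ := by
    calc ρ σ = ρ (σ * (τ * σ₀ * τ⁻¹)⁻¹) * ρ (τ * σ₀ * τ⁻¹) := by
          rw [← map_mul, inv_mul_cancel_right]
      _ = ρ (τ * σ₀ * τ⁻¹) := by
          rw [hρ, galoisRepTate_eq_one_of_mem_inertia (W := W) (ℓ := ℓ) hv hℓ h𝔓 hI, one_mul]
      _ = ρ τ * ρ σ₀ * ρ τ⁻¹ := by rw [map_mul, map_mul]
  have hττ : ∀ x, ρ τ⁻¹ (ρ τ x) = x := fun x ↦ by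
    rw [← Module.End.mul_apply, ← map_mul, inv_mul_cancel, map_one, Module.End.one_apply]
  have hττ' : ∀ x, ρ τ (ρ τ⁻¹ x) = x := fun x ↦ by
    rw [← Module.End.mul_apply, ← map_mul, mul_inv_cancel, map_one, Module.End.one_apply]
  let eτ : W.tateModule ℓ ≃ₗ[ℤ_[ℓ]] W.tateModule ℓ :=
    { toLinearMap := ρ τ⁻¹
      invFun := ρ τ
      left_inv := hττ'
      right_inv := hττ }
  refine ⟨eτ.trans e₀, LinearMap.ext fun a ↦ ?_⟩
  change e₀ (ρ τ⁻¹ (ρ σ a)) = (W.reductionAt v).galoisRepTate ℓ φ (e₀ (ρ τ⁻¹ a))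
  rw [hρσ, Module.End.mul_apply, Module.End.mul_apply, hττ, galoisRepTate_apply_apply, hρ,
    galoisRepTate_apply_apply, he₀σ]
  rfl


/-! ## Consequences: the trace of Frobenius and the Euler factors at the good places -/

section Consequences

variable (ℓ : ℕ) [Fact ℓ.Prime]

/-- **Silverman AEC C.21 Remark 21.3 (trace), reduced to V.2.3.1 over the residue fields.**
With the reduction isomorphism now proved (`galoisRepTate_frobenius_conj_reductionAt_holds`),
the named fact `W.trace_galoisRepTate_frobenius_of_hasGoodReductionAt ℓ` (`tr ρ_{E,ℓ}(Frob_v) = a_v`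
at the good places `v ∤ ℓ`) follows from the trace half of Thm. V.2.3.1 for the elliptic curves
`Ẽ_v / k_v` (named fact `WeierstrassCurve.trace_galoisRepTate_frobenius`, file
`FrobeniusTateModule`).
[cite: SilvermanAEC2009, C.21 Remark 21.3, via Thm. V.2.3.1 and Prop. VII.4.1] -/
theorem trace_galoisRepTate_frobenius_of_hasGoodReductionAt_of_finiteField
    (htr : ∀ v : HeightOneSpectrum (𝓞 K), (W.reductionAt v).trace_galoisRepTate_frobenius ℓ) :
    W.trace_galoisRepTate_frobenius_of_hasGoodReductionAt ℓ :=
  trace_galoisRepTate_frobenius_of_hasGoodReductionAt_of_conj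
    (galoisRepTate_frobenius_conj_reductionAt_holds (W := W)) htr

/-- **`L_v(E, T) = det(1 - Frob_v T | V_ℓ E)` at the good places, from the Weil pairing and
V.2.3.1** (the named fact `W.hasseWeilEulerFactor_of_hasGoodReduction ℓ` of
`HasseWeilGoodReduction`, Silverman C.§16 / C.21.3): granted the Weil pairings on `E[ℓ^{n+1}]`
(Prop. III.8.1, `exists_weilPairing`) and the trace of Frobenius on `T_ℓ Ẽ_v` for the reductions
(Thm. V.2.3.1), everything else — unramifiedness (VII.4.1), `det = χ_ℓ`, and the reduction
isomorphism `T_ℓ E ≅ T_ℓ Ẽ_v` — is proved in the tree.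
[cite: SilvermanAEC2009, C.§16 and C.21 Rem. 21.3, via Prop. III.8.1, VII.4.1, Thm. V.2.3.1] -/
theorem hasseWeilEulerFactor_of_hasGoodReduction_of_weilPairing_of_finiteField
    (hW : ∀ n : ℕ, W.exists_weilPairing (ℓ ^ (n + 1)))
    (htr : ∀ v : HeightOneSpectrum (𝓞 K), (W.reductionAt v).trace_galoisRepTate_frobenius ℓ) :
    W.hasseWeilEulerFactor_of_hasGoodReduction ℓ :=
  hasseWeilEulerFactor_of_hasGoodReduction_of_facts hW
    (galoisRepTate_frobenius_conj_reductionAt_holds (W := W)) htr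

/-- **The Euler factors at the good places from the Weil pairings, Prop. III.8.6 and
Thm. III.4.10(a).**  Combining the previous theorem with the tree's reduction of V.2.3.1
(`trace_galoisRepTate_frobenius_of_exists_weilPairing`, file `FrobeniusTateModuleProofs`:
`tr φ_ℓ = 1 + det φ_ℓ - det(1 - φ_ℓ)` with `det = deg` (III.8.6) and `deg(1 - φ) = #ker = #Ẽ(k)`
(III.4.10(a); III.5.5 is proved, `isSeparable_oneSubFrobeniusIsogeny_holds`)), the named fact
`W.hasseWeilEulerFactor_of_hasGoodReduction ℓ` follows from: Weil pairings on `E` and on the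
reductions `Ẽ_v` (III.8.1), `det T_ℓ(ψ) = deg ψ` for isogenies of `Ẽ_v` (III.8.6), and
`#ker ψ = deg_s ψ` (III.4.10(a)).
[cite: SilvermanAEC2009, C.§16, via Prop. III.8.1, III.8.6, Thm. III.4.10(a), V.2.3.1, VII.4.1] -/
theorem hasseWeilEulerFactor_of_hasGoodReduction_of_weilPairing_of_deg
    (hW : ∀ n : ℕ, W.exists_weilPairing (ℓ ^ (n + 1)))
    (hWv : ∀ (v : HeightOneSpectrum (𝓞 K)) (n : ℕ),
      (W.reductionAt v).exists_weilPairing (ℓ ^ (n + 1)))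
    (h86 : ∀ v : HeightOneSpectrum (𝓞 K), Isogeny.det_tateModule_map_eq_deg (W.reductionAt v) ℓ)
    (h410 : ∀ v : HeightOneSpectrum (𝓞 K),
      Isogeny.card_ker_eq_finSepDegree (W.reductionAt v) (W.reductionAt v)) :
    W.hasseWeilEulerFactor_of_hasGoodReduction ℓ :=
  hasseWeilEulerFactor_of_hasGoodReduction_of_weilPairing_of_finiteField (W := W) ℓ hW fun v ↦
    trace_galoisRepTate_frobenius_of_exists_weilPairing (W.reductionAt v) ℓ (hWv v) (h86 v) (h410 v)
      (isSeparable_oneSubFrobeniusIsogeny_holds (W.reductionAt v))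

end Consequences

end WeierstrassCurve
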